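import Literature.Analysis.FunctionSpaces.SobolevDomainProofs
import Literature.Analysis.OperatorTheory.AbstractHodgeDecomposition
import Literature.Analysis.OperatorTheory.PeetreLemma
import Mathlib.Analysis.Calculus.BumpFunction.FiniteDimension
import HarnessLib

/-!
# Rellich's criterion with a confining potential (gradient form, on the `C¹_c` core)

Reed–Simon IV, Theorem XIII.65 (Rellich's criterion): if `F → ∞` and `G → ∞` on `ℝⁿ` then
`{ψ : ∫ |ψ|² ≤ 1, ∫ F |ψ|² ≤ 1, ∫ G(p) |ψ̂(p)|² dp ≤ 1}` is a compact subset of `L²(ℝⁿ)`; with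
`G(p) = p²` (so that `∫ G |ψ̂|² = ∫ |∇ψ|²`) this is the compactness step in the proof that
`-Δ + V` has compact resolvent (purely discrete spectrum, complete set of eigenfunctions) when
`V ≥ 0` and `V → ∞` (Reed–Simon IV, Theorem XIII.67).

This file proves the `G(p) = p²` case in the form in which it is used on a form core: on a
finite-dimensional real normed space `E'` with an additive Haar measure `μ`, let `W ≥ 0` be
*confining* (`∀ M, ∃ R, ‖x‖ ≥ R → W x ≥ M`) and let `u : ℕ → E' → F` (`F` a proper real normed
space, e.g. `ℝ`, `ℂ`) be `C¹` functions of compact support with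
`∫ ‖uₙ‖² ≤ A`, `∫ ‖Duₙ‖² ≤ B`, `∫ W ‖uₙ‖² ≤ C`. Then for every `ε > 0` finitely many of the `uₙ`
are `ε`-dense among all of them in `L²(μ)`:

* `exists_finset_integral_norm_sub_sq_lt_of_confining` — `∃ s` finite, `∀ n, ∃ m ∈ s, ∫ ‖uₙ - uₘ‖² < ε`;
* `exists_finset_eLpNorm_sub_lt_of_confining` — the same with `eLpNorm (uₙ - uₘ) 2 μ < ε`
  (`…_of_continuous`: `W` continuous, the side condition `W ‖uₙ‖² ∈ L¹` dropped);
* `totallyBounded_Lp_of_confining` — the set of `L²` classes of such `u` (bounds `A, B, C`) is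
  totally bounded in `Lp F 2 μ`, hence relatively compact (Rellich's criterion on the core).

Proof (Reed–Simon's "tails are uniformly small" mechanism, *loc. cit.* discussion before
Thm XIII.65, made quantitative): confinement gives the uniform tail bound
`∫_{‖x‖ ≥ R} ‖uₙ‖² ≤ C / M`; a smooth cut-off `η = 1` on `B_R`, supported in `B_{2R}`, turns the
family into `η uₙ`, which is bounded in `W^{1,2}` with supports in a fixed compact set, so the
tree's `C¹` Kolmogorov–Riesz–Rellich–Kondrachov lemma
`Literature.Analysis.FunctionSpaces.exists_finset_eLpNorm_sub_lt` (Evans §5.7 / Adams Thm 2.21)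
gives a finite `ε/4`-net; the two pieces are recombined pointwise.

## References
* [ReedSimonIV1978] M. Reed, B. Simon, *Methods of Modern Mathematical Physics IV: Analysis of
  Operators*, Academic Press 1978, §XIII.14, Thm XIII.65 (Rellich's criterion, p. 247) and
  Thm XIII.67 (p. 249) (held copy, chunks p0233, p0235).
* [Adams1975] R. A. Adams, *Sobolev Spaces*, Academic Press 1975, Thm 2.21.
-/

open MeasureTheory Filter Set Metric _root_.Topology
open scoped ENNReal NNReal ContDiff

noncomputable section

namespace Literature.Analysis.FunctionSpaces

/-! ### `L²` bookkeeping -/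

section L2

variable {X : Type*} [MeasurableSpace X] {μ : Measure X}
variable {H : Type*} [NormedAddCommGroup H]

/-- `‖f‖_{L²(μ)} = √(∫ ‖f‖² dμ)` for `f ∈ L²`. [folklore] -/
private theorem eLpNorm_two_eq_ofReal_sqrt_of_memLp {f : X → H} (hf : MemLp f 2 μ) :
    eLpNorm f 2 μ = ENNReal.ofReal (Real.sqrt (∫ x, ‖f x‖ ^ 2 ∂μ)) := by
  rw [hf.eLpNorm_eq_integral_rpow_norm two_ne_zero ENNReal.ofNat_ne_top, Real.sqrt_eq_rpow]
  simp only [ENNReal.toReal_ofNat, Real.rpow_two, one_div]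

/-- `‖f‖_{L²(μ)} ≤ a` from `∫ ‖f‖² ≤ a²`-type information: if `∫ ‖f‖² ≤ b` then
`eLpNorm f 2 μ ≤ ofReal (√b)`. [folklore] -/
private theorem eLpNorm_two_le_ofReal_sqrt_of_integral_le {f : X → H} (hf : MemLp f 2 μ) {b : ℝ}
    (h : ∫ x, ‖f x‖ ^ 2 ∂μ ≤ b) : eLpNorm f 2 μ ≤ ENNReal.ofReal (Real.sqrt b) := by
  rw [eLpNorm_two_eq_ofReal_sqrt_of_memLp hf]
  exact ENNReal.ofReal_le_ofReal (Real.sqrt_le_sqrt h)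

/-- If `‖f‖_{L²(μ)} < ofReal (√b)` then `∫ ‖f‖² < b`. [folklore] -/
private theorem integral_norm_sq_lt_of_eLpNorm_two_lt {f : X → H} (hf : MemLp f 2 μ) {b : ℝ} (hb : 0 < b)
    (h : eLpNorm f 2 μ < ENNReal.ofReal (Real.sqrt b)) : ∫ x, ‖f x‖ ^ 2 ∂μ < b := by
  rw [eLpNorm_two_eq_ofReal_sqrt_of_memLp hf,
    ENNReal.ofReal_lt_ofReal_iff (Real.sqrt_pos.2 hb),
    Real.sqrt_lt_sqrt_iff (integral_nonneg fun x => sq_nonneg _)] at h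
  exact h

end L2

section CompactSupport

variable {X : Type*} [TopologicalSpace X] [MeasurableSpace X] [OpensMeasurableSpace X]
  {μ : Measure X} [IsFiniteMeasureOnCompacts μ]
variable {H : Type*} [NormedAddCommGroup H]

/-- A continuous function of compact support has `∫ ‖f‖² < ∞` on a measure finite on compacts.
[folklore] -/
private theorem integrable_norm_sq_of_continuous_of_hasCompactSupport {f : X → H} (hf : Continuous f)
    (hfs : HasCompactSupport f) : Integrable (fun x => ‖f x‖ ^ 2) μ :=
  (hf.norm.pow 2).integrable_of_hasCompactSupport
    (hfs.mono (Function.support_subset_iff'.2 fun x hx => by simp [Function.notMem_support.1 hx]))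

end CompactSupport

/-! ### Rellich's criterion with a confining weight -/

section Confining

variable {E' : Type*} [NormedAddCommGroup E'] [NormedSpace ℝ E'] [MeasurableSpace E']
  [BorelSpace E'] [FiniteDimensional ℝ E']
variable {F : Type*} [NormedAddCommGroup F] [NormedSpace ℝ F] [ProperSpace F]

omit [NormedSpace ℝ E'] [FiniteDimensional ℝ E'] [NormedSpace ℝ F] [ProperSpace F] in
/-- Integrability of `W ‖u‖²` for `W` continuous and `u` continuous of compact support (the
side condition of the theorems below, in the most common case). [folklore] -/
private theorem integrable_weight_mul_norm_sq (μ : Measure E') [IsFiniteMeasureOnCompacts μ]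
    {W : E' → ℝ} (hW : Continuous W) {u : E' → F} (hu : Continuous u) (hus : HasCompactSupport u) :
    Integrable (fun x => W x * ‖u x‖ ^ 2) μ := by
  refine (hW.mul (hu.norm.pow 2)).integrable_of_hasCompactSupport ?_
  exact hus.mono (Function.support_subset_iff'.2 fun x hx => by
    simp [Function.notMem_support.1 hx])

/-- **Rellich's criterion with a confining potential, gradient form, on the `C¹_c` core**
(Reed–Simon IV, Thm XIII.65 with `G(p) = p²`, as used in the proof of Thm XIII.67): let `μ` be
an additive Haar measure on the finite-dimensional real normed space `E'`, `W : E' → ℝ`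
nonnegative and confining (`∀ M, ∃ R, ∀ x, R ≤ ‖x‖ → M ≤ W x`), and `uₙ : E' → F` (`n : ℕ`, `F`
proper) `C¹` functions of compact support with `W ‖uₙ‖²` integrable and
`∫ ‖uₙ‖² ≤ A`, `∫ ‖Duₙ‖² ≤ B`, `∫ W ‖uₙ‖² ≤ C` for all `n`. Then for every `ε > 0` there is a
finite set `s` of indices such that every `uₙ` satisfies `∫ ‖uₙ - uₘ‖² dμ < ε` for some `m ∈ s`
(the family is totally bounded in `L²(μ)`).
[cite: ReedSimonIV1978, Thm. XIII.65 (Rellich's criterion), §XIII.14 p. 247; Thm. XIII.67 (proof)] -/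
theorem exists_finset_integral_norm_sub_sq_lt_of_confining (μ : Measure E') [μ.IsAddHaarMeasure]
    {W : E' → ℝ} (hW0 : ∀ x, 0 ≤ W x) (hW : ∀ M : ℝ, ∃ R : ℝ, ∀ x, R ≤ ‖x‖ → M ≤ W x)
    (u : ℕ → E' → F) (hu : ∀ n, ContDiff ℝ 1 (u n)) (hus : ∀ n, HasCompactSupport (u n))
    (hWu : ∀ n, Integrable (fun x => W x * ‖u n x‖ ^ 2) μ) {A B C : ℝ}
    (huA : ∀ n, ∫ x, ‖u n x‖ ^ 2 ∂μ ≤ A) (huB : ∀ n, ∫ x, ‖fderiv ℝ (u n) x‖ ^ 2 ∂μ ≤ B)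
    (huC : ∀ n, ∫ x, W x * ‖u n x‖ ^ 2 ∂μ ≤ C) {ε : ℝ} (hε : 0 < ε) :
    ∃ s : Finset ℕ, ∀ n, ∃ m ∈ s, ∫ x, ‖u n x - u m x‖ ^ 2 ∂μ < ε := by
  -- basic facts about the `uₙ`
  have huc : ∀ n, Continuous (u n) := fun n => (hu n).continuous
  have hud : ∀ n, Differentiable ℝ (u n) := fun n => (hu n).differentiable (by simp)
  have huDc : ∀ n, Continuous fun x => fderiv ℝ (u n) x := fun n =>
    (hu n).continuous_fderiv (by simp)
  have huDs : ∀ n, HasCompactSupport fun x => fderiv ℝ (u n) x := fun n =>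
    (hus n).fderiv (𝕜 := ℝ)
  have hint_sq : ∀ n, Integrable (fun x => ‖u n x‖ ^ 2) μ := fun n =>
    integrable_norm_sq_of_continuous_of_hasCompactSupport (huc n) (hus n)
  -- nonnegativity of the constants
  have hA0 : 0 ≤ A := (integral_nonneg fun x => sq_nonneg _).trans (huA 0)
  have hB0 : 0 ≤ B := (integral_nonneg fun x => sq_nonneg _).trans (huB 0)
  have hC0 : 0 ≤ C :=
    (integral_nonneg fun x => mul_nonneg (hW0 x) (sq_nonneg _)).trans (huC 0)
  -- Step 1: the confinement radius.  `M = 32 C / ε + 1`, so that `8 C / M ≤ ε / 4`.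
  set M : ℝ := 32 * C / ε + 1 with hM
  have hM0 : 0 < M := by positivity
  have hCM : 8 * C / M ≤ ε / 4 := by
    rw [div_le_iff₀ hM0, hM]
    have : 8 * C = ε / 4 * (32 * C / ε) := by field_simp; ring
    rw [this]
    nlinarith
  obtain ⟨R₀, hR₀⟩ := hW M
  set R : ℝ := max R₀ 1 with hR
  have hR1 : 1 ≤ R := le_max_right _ _
  have hR0 : 0 < R := by positivity
  have hWR : ∀ x, R ≤ ‖x‖ → M ≤ W x := fun x hx => hR₀ x ((le_max_left _ _).trans hx)
  -- Step 2: the cut-off `η = 1` on `B_R`, supported in `B_{2R}`, `‖Dη‖ ≤ L`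
  let η : ContDiffBump (0 : E') := ⟨R, 2 * R, hR0, by linarith⟩
  have hηc : ContDiff ℝ ∞ (η : E' → ℝ) := η.contDiff
  have hηs : HasCompactSupport (η : E' → ℝ) := η.hasCompactSupport
  have hηd : Differentiable ℝ (η : E' → ℝ) := hηc.differentiable (by simp)
  obtain ⟨L, hL⟩ :=
    (hηc.continuous_fderiv (by simp)).bounded_above_of_compact_support (hηs.fderiv (𝕜 := ℝ))
  have hL0 : 0 ≤ L := (norm_nonneg _).trans (hL 0)
  have hη01 : ∀ x, 0 ≤ 1 - η x ∧ 1 - η x ≤ 1 := fun x =>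
    ⟨sub_nonneg.2 η.le_one, by linarith [η.nonneg (x := x)]⟩
  -- Step 3: the cut-off family `φₙ = η • uₙ`
  set φ : ℕ → E' → F := fun n x => η x • u n x with hφ
  have hφC : ∀ n, ContDiff ℝ 1 (φ n) := fun n => (hηc.of_le (by simp)).smul (hu n)
  have hφc : ∀ n, Continuous (φ n) := fun n => (hφC n).continuous
  have hφs : ∀ n, HasCompactSupport (φ n) := fun n => (hus n).smul_left
  set K : Set E' := closedBall (0 : E') (2 * R) with hK
  have hKc : IsCompact K := isCompact_closedBall _ _
  have hφK : ∀ n, tsupport (φ n) ⊆ K := by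
    intro n
    refine (tsupport_smul_subset_left _ _).trans ?_
    rw [η.tsupport_eq]
  have hmemφ : ∀ n, MemLp (φ n) 2 μ := fun n => (hφc n).memLp_of_hasCompactSupport (hφs n)
  -- (a) `‖φₙ‖_{L²} ≤ √A`
  have hφ_le : ∀ n x, ‖φ n x‖ ≤ ‖u n x‖ := by
    intro n x
    rw [hφ]; dsimp only
    rw [norm_smul, Real.norm_of_nonneg η.nonneg]
    exact mul_le_of_le_one_left (norm_nonneg _) η.le_one
  have hmemu : ∀ n, MemLp (u n) 2 μ := fun n => (huc n).memLp_of_hasCompactSupport (hus n)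
  have hφA : ∀ n, eLpNorm (φ n) 2 μ ≤ ENNReal.ofReal (Real.sqrt A) := fun n =>
    (eLpNorm_mono (hφ_le n)).trans (eLpNorm_two_le_ofReal_sqrt_of_integral_le (hmemu n) (huA n))
  -- (b) `‖Dφₙ‖_{L²} ≤ √(2B + 2L²A)` via the real majorant `gₙ = ‖Duₙ‖ + L ‖uₙ‖`
  set g : ℕ → E' → ℝ := fun n x => ‖fderiv ℝ (u n) x‖ + L * ‖u n x‖ with hg
  have hgc : ∀ n, Continuous (g n) := fun n =>
    (huDc n).norm.add (continuous_const.mul (huc n).norm)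
  have hgs : ∀ n, HasCompactSupport (g n) := fun n => (huDs n).norm.add (hus n).norm.mul_left
  have hmemg : ∀ n, MemLp (g n) 2 μ := fun n => (hgc n).memLp_of_hasCompactSupport (hgs n)
  have hDφ_le : ∀ n x, ‖fderiv ℝ (φ n) x‖ ≤ g n x := by
    intro n x
    have hd : HasFDerivAt (φ n)
        (η x • fderiv ℝ (u n) x + (fderiv ℝ (η : E' → ℝ) x).smulRight (u n x)) x :=
      (hηd x).hasFDerivAt.smul (hud n x).hasFDerivAt
    rw [hd.fderiv, hg]
    dsimp only
    calc _ ≤ ‖η x • fderiv ℝ (u n) x‖ + ‖(fderiv ℝ (η : E' → ℝ) x).smulRight (u n x)‖ :=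
          norm_add_le _ _
      _ ≤ ‖fderiv ℝ (u n) x‖ + L * ‖u n x‖ := by
          rw [norm_smul, Real.norm_of_nonneg η.nonneg, ContinuousLinearMap.norm_smulRight_apply]
          exact add_le_add (mul_le_of_le_one_left (norm_nonneg _) η.le_one)
            (mul_le_mul_of_nonneg_right (hL x) (norm_nonneg _))
  have hg_sq_le : ∀ n x, ‖g n x‖ ^ 2 ≤ 2 * ‖fderiv ℝ (u n) x‖ ^ 2 + 2 * L ^ 2 * ‖u n x‖ ^ 2 := by
    intro n x
    rw [hg]; dsimp only
    rw [Real.norm_of_nonneg (by positivity)]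
    nlinarith [sq_nonneg (‖fderiv ℝ (u n) x‖ - L * ‖u n x‖)]
  have hgB : ∀ n, ∫ x, ‖g n x‖ ^ 2 ∂μ ≤ 2 * B + 2 * L ^ 2 * A := by
    intro n
    have hi1 : Integrable (fun x => ‖fderiv ℝ (u n) x‖ ^ 2) μ :=
      integrable_norm_sq_of_continuous_of_hasCompactSupport (huDc n) (huDs n)
    have hi : Integrable (fun x => 2 * ‖fderiv ℝ (u n) x‖ ^ 2 + 2 * L ^ 2 * ‖u n x‖ ^ 2) μ :=
      (hi1.const_mul 2).add ((hint_sq n).const_mul (2 * L ^ 2))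
    calc ∫ x, ‖g n x‖ ^ 2 ∂μ ≤ ∫ x, 2 * ‖fderiv ℝ (u n) x‖ ^ 2 + 2 * L ^ 2 * ‖u n x‖ ^ 2 ∂μ :=
          integral_mono_of_nonneg (Eventually.of_forall fun x => sq_nonneg _) hi
            (Eventually.of_forall (hg_sq_le n))
      _ = 2 * ∫ x, ‖fderiv ℝ (u n) x‖ ^ 2 ∂μ + 2 * L ^ 2 * ∫ x, ‖u n x‖ ^ 2 ∂μ := by
          rw [integral_add (hi1.const_mul 2) ((hint_sq n).const_mul _), integral_const_mul,
            integral_const_mul]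
      _ ≤ 2 * B + 2 * L ^ 2 * A := by
          have h1 := huB n
          have h2 := mul_le_mul_of_nonneg_left (huA n) (by positivity : (0 : ℝ) ≤ 2 * L ^ 2)
          linarith
  have hφB : ∀ n, eLpNorm (fderiv ℝ (φ n)) 2 μ ≤ ENNReal.ofReal (Real.sqrt (2 * B + 2 * L ^ 2 * A)) :=
    fun n => (eLpNorm_mono_real (hDφ_le n)).trans (eLpNorm_two_le_ofReal_sqrt_of_integral_le (hmemg n) (hgB n))
  -- Step 4: a finite `ε/4`-net among the `φₙ` (Kolmogorov–Riesz, `C¹` form)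
  have hε4 : (0 : ℝ) < ε / 4 := by positivity
  have hε4' : (0 : ℝ≥0∞) < ENNReal.ofReal (Real.sqrt (ε / 4)) :=
    ENNReal.ofReal_pos.2 (Real.sqrt_pos.2 hε4)
  obtain ⟨s, hs⟩ := exists_finset_eLpNorm_sub_lt μ (p := 2) (F := F) one_le_two hKc φ hφC hφK
    ENNReal.ofReal_ne_top ENNReal.ofReal_ne_top hφA hφB hε4'
  refine ⟨s, fun n => ?_⟩
  obtain ⟨m, hm, hnm⟩ := hs n
  refine ⟨m, hm, ?_⟩
  -- `∫ ‖φₙ - φₘ‖² < ε / 4`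
  have hφnm : ∫ x, ‖φ n x - φ m x‖ ^ 2 ∂μ < ε / 4 :=
    integral_norm_sq_lt_of_eLpNorm_two_lt ((hmemφ n).sub (hmemφ m)) hε4 hnm
  -- Step 5: the tails.  Pointwise `(1 - η)² ‖u‖² ≤ W ‖u‖² / M`.
  have htail : ∀ k x, (1 - η x) ^ 2 * ‖u k x‖ ^ 2 ≤ M⁻¹ * (W x * ‖u k x‖ ^ 2) := by
    intro k x
    by_cases hx : ‖x‖ ≤ R
    · have h1 : η x = 1 :=
        η.one_of_mem_closedBall (by rw [mem_closedBall, dist_zero_right]; exact hx)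
      rw [h1, sub_self, zero_pow two_ne_zero, zero_mul]
      exact mul_nonneg (inv_nonneg.2 hM0.le) (mul_nonneg (hW0 x) (sq_nonneg _))
    · push Not at hx
      have hWx : M ≤ W x := hWR x hx.le
      have hsq1 : (1 - η x) ^ 2 ≤ 1 := by nlinarith [(hη01 x).1, (hη01 x).2]
      have hrat : 1 ≤ M⁻¹ * W x := by
        rw [inv_mul_eq_div, le_div_iff₀ hM0, one_mul]; exact hWx
      calc (1 - η x) ^ 2 * ‖u k x‖ ^ 2 ≤ 1 * ‖u k x‖ ^ 2 :=
            mul_le_mul_of_nonneg_right hsq1 (sq_nonneg _)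
        _ ≤ (M⁻¹ * W x) * ‖u k x‖ ^ 2 := mul_le_mul_of_nonneg_right hrat (sq_nonneg _)
        _ = M⁻¹ * (W x * ‖u k x‖ ^ 2) := by ring
  -- Step 6: pointwise recombination (`‖a + b‖² ≤ 2‖a‖² + 2‖b‖²`)
  have hsq_add : ∀ a b : F, ‖a + b‖ ^ 2 ≤ 2 * ‖a‖ ^ 2 + 2 * ‖b‖ ^ 2 := fun a b => by
    have h := norm_add_le a b
    nlinarith [sq_nonneg (‖a‖ - ‖b‖), norm_nonneg (a + b), norm_nonneg a, norm_nonneg b]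
  have hpt : ∀ x, ‖u n x - u m x‖ ^ 2 ≤
      2 * ‖φ n x - φ m x‖ ^ 2 + 4 * M⁻¹ * (W x * ‖u n x‖ ^ 2) + 4 * M⁻¹ * (W x * ‖u m x‖ ^ 2) := by
    intro x
    have hdec : u n x - u m x = (φ n x - φ m x) + (1 - η x) • (u n x - u m x) := by
      rw [hφ]; dsimp only
      rw [sub_smul, one_smul, smul_sub]
      abel
    have h1 := hsq_add (φ n x - φ m x) ((1 - η x) • (u n x - u m x))
    have h2 : ‖(1 - η x) • (u n x - u m x)‖ ^ 2 = (1 - η x) ^ 2 * ‖u n x - u m x‖ ^ 2 := by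
      rw [norm_smul, Real.norm_of_nonneg (hη01 x).1, mul_pow]
    have h3 := hsq_add (u n x) (-u m x)
    rw [← sub_eq_add_neg, norm_neg] at h3
    have h4 := htail n x
    have h5 := htail m x
    have h6 : (1 - η x) ^ 2 * ‖u n x - u m x‖ ^ 2 ≤
        2 * (M⁻¹ * (W x * ‖u n x‖ ^ 2)) + 2 * (M⁻¹ * (W x * ‖u m x‖ ^ 2)) := by
      calc (1 - η x) ^ 2 * ‖u n x - u m x‖ ^ 2
          ≤ (1 - η x) ^ 2 * (2 * ‖u n x‖ ^ 2 + 2 * ‖u m x‖ ^ 2) :=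
            mul_le_mul_of_nonneg_left h3 (sq_nonneg _)
        _ = 2 * ((1 - η x) ^ 2 * ‖u n x‖ ^ 2) + 2 * ((1 - η x) ^ 2 * ‖u m x‖ ^ 2) := by ring
        _ ≤ _ := by linarith
    rw [← hdec] at h1
    linarith
  -- Step 7: integrate
  have hφcs : HasCompactSupport fun x => φ n x - φ m x := (hφs n).sub (hφs m)
  have hiφ : Integrable (fun x => ‖φ n x - φ m x‖ ^ 2) μ :=
    integrable_norm_sq_of_continuous_of_hasCompactSupport ((hφc n).sub (hφc m)) hφcs
  have hI1 : Integrable (fun x => 2 * ‖φ n x - φ m x‖ ^ 2) μ := hiφ.const_mul 2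
  have hI2 : Integrable (fun x => 4 * M⁻¹ * (W x * ‖u n x‖ ^ 2)) μ := (hWu n).const_mul _
  have hI3 : Integrable (fun x => 4 * M⁻¹ * (W x * ‖u m x‖ ^ 2)) μ := (hWu m).const_mul _
  have hI12 : Integrable (fun x => 2 * ‖φ n x - φ m x‖ ^ 2 + 4 * M⁻¹ * (W x * ‖u n x‖ ^ 2)) μ :=
    hI1.add hI2
  have hrhs : Integrable (fun x => 2 * ‖φ n x - φ m x‖ ^ 2 + 4 * M⁻¹ * (W x * ‖u n x‖ ^ 2) +
      4 * M⁻¹ * (W x * ‖u m x‖ ^ 2)) μ := hI12.add hI3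
  calc ∫ x, ‖u n x - u m x‖ ^ 2 ∂μ
      ≤ ∫ x, 2 * ‖φ n x - φ m x‖ ^ 2 + 4 * M⁻¹ * (W x * ‖u n x‖ ^ 2) +
          4 * M⁻¹ * (W x * ‖u m x‖ ^ 2) ∂μ :=
        integral_mono_of_nonneg (Eventually.of_forall fun x => sq_nonneg _) hrhs
          (Eventually.of_forall hpt)
    _ = 2 * ∫ x, ‖φ n x - φ m x‖ ^ 2 ∂μ + 4 * M⁻¹ * ∫ x, W x * ‖u n x‖ ^ 2 ∂μ +
          4 * M⁻¹ * ∫ x, W x * ‖u m x‖ ^ 2 ∂μ := by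
        rw [integral_add hI12 hI3, integral_add hI1 hI2, integral_const_mul, integral_const_mul,
          integral_const_mul]
    _ ≤ 2 * (ε / 4) + 4 * M⁻¹ * C + 4 * M⁻¹ * C := by
        have hM' : (0 : ℝ) ≤ 4 * M⁻¹ := by positivity
        have h1 := mul_le_mul_of_nonneg_left (huC n) hM'
        have h2 := mul_le_mul_of_nonneg_left (huC m) hM'
        linarith
    _ = ε / 2 + 8 * C / M := by rw [div_eq_mul_inv (8 * C) M]; ring
    _ < ε := by linarith

/-- `L²`-seminorm form of `exists_finset_integral_norm_sub_sq_lt_of_confining`: under the same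
hypotheses, for every `ε > 0` in `ℝ≥0∞` finitely many of the `uₙ` are `ε`-dense among all of
them for `eLpNorm · 2 μ`.
[cite: ReedSimonIV1978, Thm. XIII.65 (Rellich's criterion), §XIII.14 p. 247] -/
theorem exists_finset_eLpNorm_sub_lt_of_confining (μ : Measure E') [μ.IsAddHaarMeasure]
    {W : E' → ℝ} (hW0 : ∀ x, 0 ≤ W x) (hW : ∀ M : ℝ, ∃ R : ℝ, ∀ x, R ≤ ‖x‖ → M ≤ W x)
    (u : ℕ → E' → F) (hu : ∀ n, ContDiff ℝ 1 (u n)) (hus : ∀ n, HasCompactSupport (u n))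
    (hWu : ∀ n, Integrable (fun x => W x * ‖u n x‖ ^ 2) μ) {A B C : ℝ}
    (huA : ∀ n, ∫ x, ‖u n x‖ ^ 2 ∂μ ≤ A) (huB : ∀ n, ∫ x, ‖fderiv ℝ (u n) x‖ ^ 2 ∂μ ≤ B)
    (huC : ∀ n, ∫ x, W x * ‖u n x‖ ^ 2 ∂μ ≤ C) {ε : ℝ≥0∞} (hε : 0 < ε) :
    ∃ s : Finset ℕ, ∀ n, ∃ m ∈ s, eLpNorm (u n - u m) 2 μ < ε := by
  -- reduce to finite `ε`
  wlog hεt : ε ≠ (⊤ : ℝ≥0∞) generalizing ε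
  · obtain ⟨s, hs⟩ := this one_pos ENNReal.one_ne_top
    refine ⟨s, fun n => (hs n).imp fun m hm => ⟨hm.1, hm.2.trans_le ?_⟩⟩
    rw [not_ne_iff.1 hεt]; exact le_top
  have hε' : 0 < ε.toReal := ENNReal.toReal_pos hε.ne' hεt
  have hmemu : ∀ n, MemLp (u n) 2 μ := fun n =>
    (hu n).continuous.memLp_of_hasCompactSupport (hus n)
  obtain ⟨s, hs⟩ := exists_finset_integral_norm_sub_sq_lt_of_confining μ hW0 hW u hu hus hWu
    huA huB huC (ε := ε.toReal ^ 2) (by positivity)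
  refine ⟨s, fun n => (hs n).imp fun m hm => ⟨hm.1, ?_⟩⟩
  have hmem : MemLp (u n - u m) 2 μ := (hmemu n).sub (hmemu m)
  rw [eLpNorm_two_eq_ofReal_sqrt_of_memLp hmem]
  calc ENNReal.ofReal (Real.sqrt (∫ x, ‖(u n - u m) x‖ ^ 2 ∂μ))
      < ENNReal.ofReal (Real.sqrt (ε.toReal ^ 2)) := by
        rw [ENNReal.ofReal_lt_ofReal_iff (Real.sqrt_pos.2 (by positivity)),
          Real.sqrt_lt_sqrt_iff (integral_nonneg fun x => sq_nonneg _)]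
        exact hm.2
    _ = ε := by rw [Real.sqrt_sq hε'.le, ENNReal.ofReal_toReal hεt]

/-- Continuous-weight form of `exists_finset_eLpNorm_sub_lt_of_confining` (the side condition
`W ‖uₙ‖² ∈ L¹` is then automatic): `W ≥ 0` continuous and confining, `uₙ` `C¹` of compact
support with `∫ ‖uₙ‖² ≤ A`, `∫ ‖Duₙ‖² ≤ B`, `∫ W ‖uₙ‖² ≤ C` ⇒ finite `ε`-nets in `L²(μ)`.
[cite: ReedSimonIV1978, Thm. XIII.65 (Rellich's criterion), §XIII.14 p. 247] -/
theorem exists_finset_eLpNorm_sub_lt_of_confining_of_continuous (μ : Measure E')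
    [μ.IsAddHaarMeasure] {W : E' → ℝ} (hWc : Continuous W) (hW0 : ∀ x, 0 ≤ W x)
    (hW : ∀ M : ℝ, ∃ R : ℝ, ∀ x, R ≤ ‖x‖ → M ≤ W x)
    (u : ℕ → E' → F) (hu : ∀ n, ContDiff ℝ 1 (u n)) (hus : ∀ n, HasCompactSupport (u n))
    {A B C : ℝ} (huA : ∀ n, ∫ x, ‖u n x‖ ^ 2 ∂μ ≤ A)
    (huB : ∀ n, ∫ x, ‖fderiv ℝ (u n) x‖ ^ 2 ∂μ ≤ B)
    (huC : ∀ n, ∫ x, W x * ‖u n x‖ ^ 2 ∂μ ≤ C) {ε : ℝ≥0∞} (hε : 0 < ε) :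
    ∃ s : Finset ℕ, ∀ n, ∃ m ∈ s, eLpNorm (u n - u m) 2 μ < ε :=
  exists_finset_eLpNorm_sub_lt_of_confining μ hW0 hW u hu hus
    (fun n => integrable_weight_mul_norm_sq μ hWc (hu n).continuous (hus n)) huA huB huC hε

/-- **Rellich's criterion on the `C¹_c` core, set form** (Reed–Simon IV, Thm XIII.65 with
`G(p) = p²`): for `W ≥ 0` confining and any bounds `A, B, C`, the set of `L²(μ)`-classes of
`C¹` compactly supported `u : E' → F` with `∫ ‖u‖² ≤ A`, `∫ ‖Du‖² ≤ B`, `∫ W ‖u‖² ≤ C` is totally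
bounded in `Lp F 2 μ` (hence has compact closure, `L²` being complete).  This is the input
"`{ψ : ‖ψ‖ ≤ 1, (ψ, Hψ) ≤ b}` is precompact" of Reed–Simon IV, Thm XIII.64 (iv) ⇒ compact resolvent
of `H = -Δ + W` (Thm XIII.67), on the form core.
[cite: ReedSimonIV1978, Thm. XIII.65 (Rellich's criterion), §XIII.14 p. 247; Thm. XIII.67 p. 249] -/
theorem totallyBounded_Lp_of_confining (μ : Measure E') [μ.IsAddHaarMeasure]
    {W : E' → ℝ} (hW0 : ∀ x, 0 ≤ W x) (hW : ∀ M : ℝ, ∃ R : ℝ, ∀ x, R ≤ ‖x‖ → M ≤ W x)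
    (A B C : ℝ) :
    TotallyBounded {v : Lp F 2 μ | ∃ u : E' → F, ContDiff ℝ 1 u ∧ HasCompactSupport u ∧
      (v : E' → F) =ᵐ[μ] u ∧ Integrable (fun x => W x * ‖u x‖ ^ 2) μ ∧
      ∫ x, ‖u x‖ ^ 2 ∂μ ≤ A ∧ ∫ x, ‖fderiv ℝ u x‖ ^ 2 ∂μ ≤ B ∧ ∫ x, W x * ‖u x‖ ^ 2 ∂μ ≤ C} := by
  refine Literature.Analysis.OperatorTheory.totallyBounded_of_forall_seq_exists_cauchySeq
    fun v hv => ?_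
  choose u hu hus hvu hWu huA huB huC using hv
  -- it suffices that the range of the sequence is totally bounded
  suffices htb : TotallyBounded (Set.range v) from
    Literature.Analysis.OperatorTheory.exists_subseq_cauchySeq_of_totallyBounded htb
      fun n => Set.mem_range_self n
  refine Metric.totallyBounded_iff.2 fun ε hε => ?_
  obtain ⟨s, hs⟩ := exists_finset_eLpNorm_sub_lt_of_confining μ hW0 hW u hu hus hWu huA huB huC
    (ε := ENNReal.ofReal ε) (ENNReal.ofReal_pos.2 hε)
  refine ⟨v '' (s : Set ℕ), s.finite_toSet.image _, ?_⟩
  rintro _ ⟨n, rfl⟩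
  obtain ⟨m, hm, hnm⟩ := hs n
  refine mem_iUnion₂.2 ⟨v m, mem_image_of_mem _ (Finset.mem_coe.2 hm), ?_⟩
  rw [mem_ball, dist_eq_norm, Lp.norm_def]
  have h1 : eLpNorm ((v n - v m : Lp F 2 μ) : E' → F) 2 μ = eLpNorm (u n - u m) 2 μ :=
    eLpNorm_congr_ae ((Lp.coeFn_sub _ _).trans ((hvu n).sub (hvu m)))
  rw [h1]
  exact ENNReal.toReal_lt_of_lt_ofReal hnm

end Confining

end Literature.Analysis.FunctionSpaces
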